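import Summits.CriticalPhenomena.PercolationContinuityZ3.Theorems.PercNearOneGluingNoHeavyPcintChordPairs
import Summits.CriticalPhenomena.PercolationContinuityZ3.Theorems.PercNearOneGluingNoHeavyPcintChordReduction
import Literature.Probability.RandomPlanarGeometry.SAWCount
import HarnessLib

/-!
# PCINT lane: weighted finite-memory walk automata, the Collatz–Wielandt bound, and the window automaton of kind B3

Cell `prim-pcint`, seat `prim-pcint-2`; memo `run/shared/lean/prim/pcint/REDUCTIONS.md` §R2 (R2.1–R2.5) and §B3.
Does NOT build on p205010.

§1 is a generic statement about a finite automaton with nonnegative transition weights: if a positive vector `v`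
satisfies the Collatz–Wielandt inequalities `Σ_a wt(s,a)·v(step s a) ≤ λ·v(s)` then the total weight of all
words of length `n` read from `s` is at most `λⁿ v(s)/v_min` (`WAut.total_le_of_cw`).

§2 specialises to the WINDOW automaton of a chord-weighted walk on `ℤ^d` (REDUCTIONS §R2.1, kind `chord_cw`):
states are the `m`-step windows `Fin m → Fin d × Bool`, a step `a` is accepted iff the extended window is
self-avoiding (abstract test `ok`, hypothesis `hok`), with weight `p (1-p)^{c}` where `c` is at most the number
of window vertices adjacent to the new one (abstract count `c`, hypothesis `hc`).  Soundness
(`sum_chordWeight_le_of_window`): along a self-avoiding word every window is accepted and the charged chords are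
distinct chord pairs of the word (`…PcintChordPairs.lean`), so
`Σ_{w ∈ sawWords d (m+k)} p^{m+k} (1-p)^{#chordEdges w} ≤ p^m Σ_u total_k(u)`.  With a certificate `(v, λ)`,
`λ < 1`, the B3 glue gives `p ≤ p_c^bond(ℤ^d)` — assembled in `…PcintWindowCert.lean`; this file stops at the run
identity `run_windowAut_eq` and the chord accounting `sum_winChordTrue_le_card_chordEdges`.
-/

noncomputable section

namespace Summit.CriticalPhenomena.PercolationContinuityZ3.Theorems.Pcint

open Finset Literature.Probability.Percolation Literature.Probability.LatticeModels

/-! ## §1. Weighted automata and the Collatz–Wielandt bound -/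

/-- A finite automaton with partial transition function and nonnegative real transition weights. [folklore] -/
structure WAut (S A : Type*) where
  /-- the next state, `none` = reject -/
  step : S → A → Option S
  /-- the weight of the transition -/
  wt : S → A → ℝ
  wt_nonneg : ∀ s a, 0 ≤ wt s a

namespace WAut

variable {S A : Type*} (M : WAut S A)

/-- The weight of reading the word `w` from the state `s`: the product of the transition weights, or `0` if some
step is rejected. [folklore] -/
def run : (n : ℕ) → S → (Fin n → A) → ℝ
  | 0, _, _ => 1
  | n + 1, s, w =>
    match M.step s (w 0) with
    | none => 0
    | some t => M.wt s (w 0) * run n t (Fin.tail w)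

/-- Run weights are nonnegative. [folklore] -/
theorem run_nonneg : ∀ (n : ℕ) (s : S) (w : Fin n → A), 0 ≤ M.run n s w
  | 0, _, _ => by simp [run]
  | n + 1, s, w => by
    simp only [run]
    cases h : M.step s (w 0) with
    | none => simp
    | some t => exact mul_nonneg (M.wt_nonneg _ _) (run_nonneg n t _)

/-- One step of the run. [folklore] -/
theorem run_succ (n : ℕ) (s : S) (w : Fin (n + 1) → A) :
    M.run (n + 1) s w = match M.step s (w 0) with
      | none => 0
      | some t => M.wt s (w 0) * M.run n t (Fin.tail w) := by
  simp only [run]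

variable [Fintype A]

/-- Total weight of all words of length `n` read from `s`. [folklore] -/
def total (n : ℕ) (s : S) : ℝ := ∑ w : Fin n → A, M.run n s w

/-- The one-step weight towards the value `f` of the successor (`0` on rejection). [folklore] -/
def stepSum (f : S → ℝ) (s : S) : ℝ :=
  ∑ a : A, match M.step s a with
    | none => 0
    | some t => M.wt s a * f t

/-- `total 0 = 1`. [folklore] -/
theorem total_zero (s : S) : M.total 0 s = 1 := by
  simp [total, run]

/-- The transfer recursion `total (n+1) s = Σ_a wt(s,a) · total n (step s a)`. [folklore] -/
theorem total_succ (n : ℕ) (s : S) : M.total (n + 1) s = M.stepSum (M.total n) s := by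
  classical
  unfold total stepSum
  rw [← (Fin.consEquiv (fun _ : Fin (n + 1) => A)).sum_comp, Fintype.sum_prod_type]
  refine Finset.sum_congr rfl fun a _ => ?_
  simp only [Fin.consEquiv, Equiv.coe_fn_mk, run, Fin.cons_zero, Fin.tail_cons]
  cases h : M.step s a with
  | none => simp
  | some t => simp only [Finset.mul_sum]

/-- **Collatz–Wielandt bound.** If `v ≥ v_min > 0` and `Σ_a wt(s,a) v(step s a) ≤ λ v(s)` for every state, then
`total n s ≤ λⁿ v(s) / v_min`. [folklore] -/
theorem total_le_of_cw {v : S → ℝ} {vmin lam : ℝ} (hvmin : 0 < vmin) (hv : ∀ s, vmin ≤ v s)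
    (hlam : 0 ≤ lam) (hcw : ∀ s, M.stepSum v s ≤ lam * v s) :
    ∀ (n : ℕ) (s : S), M.total n s ≤ lam ^ n * v s / vmin := by
  intro n
  induction n with
  | zero =>
    intro s
    rw [total_zero, pow_zero, one_mul, le_div_iff₀ hvmin, one_mul]
    exact hv s
  | succ n ih =>
    intro s
    rw [total_succ]
    calc M.stepSum (M.total n) s ≤ M.stepSum (fun t => lam ^ n * v t / vmin) s := by
          refine Finset.sum_le_sum fun a _ => ?_
          cases h : M.step s a with
          | none => simp
          | some t => exact mul_le_mul_of_nonneg_left (ih t) (M.wt_nonneg _ _)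
      _ = lam ^ n / vmin * M.stepSum v s := by
          rw [stepSum, stepSum, Finset.mul_sum]
          refine Finset.sum_congr rfl fun a _ => ?_
          cases h : M.step s a with
          | none => simp
          | some t => simp only; ring
      _ ≤ lam ^ n / vmin * (lam * v s) :=
          mul_le_mul_of_nonneg_left (hcw s) (div_nonneg (pow_nonneg hlam _) hvmin.le)
      _ = lam ^ (n + 1) * v s / vmin := by ring

end WAut

/-! ## §2. The window automaton of a chord-weighted walk on `ℤ^d` -/

variable {d m : ℕ}

/-- The extended window: the `m` steps of `u` followed by the step `a`. [folklore] -/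
def wext (u : Fin m → Fin d × Bool) (a : Fin d × Bool) : Fin (m + 1) → Fin d × Bool :=
  fun i => if h : i.1 < m then u ⟨i.1, h⟩ else a

/-- The shifted window: drop the first step of the extended window. [folklore] -/
def wshift (u : Fin m → Fin d × Bool) (a : Fin d × Bool) : Fin m → Fin d × Bool :=
  fun i => wext u a ⟨i.1 + 1, by omega⟩

/-- The extended window below position `m` is the old window. [folklore] -/
theorem wext_lt (u : Fin m → Fin d × Bool) (a : Fin d × Bool) {i : ℕ} (hi : i < m) :
    wext u a ⟨i, by omega⟩ = u ⟨i, hi⟩ := by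
  simp [wext, hi]

/-- The last step of the extended window is the new step. [folklore] -/
theorem wext_last (u : Fin m → Fin d × Bool) (a : Fin d × Bool) : wext u a ⟨m, by omega⟩ = a := by
  simp [wext]

/-- The number of genuine window chords from the new vertex: window vertices `v_0, …, v_{m-1}` (the predecessor
`v_m` excluded) adjacent to `v_{m+1}`. [folklore] -/
def winChordTrue (u : Fin m → Fin d × Bool) (a : Fin d × Bool) : ℕ :=
  ((Finset.range m).filter fun j =>
    (zdGraph d).Adj (wordPos (wext u a) j) (wordPos (wext u a) (m + 1))).card

/-- The chord-weighted WINDOW AUTOMATON with abstract acceptance test `ok` and chord count `c`: transition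
`u --a--> wshift u a` when `ok u a`, weight `p (1-p)^{c u a}`. [folklore] -/
def windowAut (ok : (Fin m → Fin d × Bool) → Fin d × Bool → Bool) (c : (Fin m → Fin d × Bool) → Fin d × Bool → ℕ)
    (p : ℝ) (hp0 : 0 ≤ p) (hp1 : p ≤ 1) : WAut (Fin m → Fin d × Bool) (Fin d × Bool) where
  step u a := if ok u a then some (wshift u a) else none
  wt u a := p * (1 - p) ^ c u a
  wt_nonneg u a := mul_nonneg hp0 (pow_nonneg (by linarith) _)

/-! ### Windows of a long word (junk-padded beyond its end, to avoid dependent indices) -/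

variable (a₀ : Fin d × Bool) {N : ℕ}

/-- The `i`-th step of `w`, or the junk step `a₀` beyond the end. [folklore] -/
def wordAt (w : Fin N → Fin d × Bool) (i : ℕ) : Fin d × Bool := if h : i < N then w ⟨i, h⟩ else a₀

/-- The window of `w` starting at position `t` (junk-padded). [folklore] -/
def winAt (w : Fin N → Fin d × Bool) (t : ℕ) : Fin m → Fin d × Bool := fun i => wordAt a₀ w (t + i.1)

/-- Inside the word, `wordAt` is the actual step. [folklore] -/
theorem wordAt_of_lt (w : Fin N → Fin d × Bool) {i : ℕ} (hi : i < N) : wordAt a₀ w i = w ⟨i, hi⟩ := by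
  simp [wordAt, hi]

/-- Shifting the window at `t` by the next step gives the window at `t + 1` (unconditionally). [folklore] -/
theorem wshift_winAt (w : Fin N → Fin d × Bool) (t : ℕ) :
    wshift (winAt (m := m) a₀ w t) (wordAt a₀ w (t + m)) = winAt a₀ w (t + 1) := by
  funext i
  simp only [wshift, wext, winAt]
  split_ifs with h
  · congr 1; omega
  · have : i.1 + 1 = m := by omega
    congr 1; omega

/-- The extended window at `t` reads the steps `t, …, t + m` of `w` (when inside `w`). [folklore] -/
theorem wext_winAt (w : Fin N → Fin d × Bool) {t : ℕ} (ht : t + m < N) {i : ℕ} (hi : i ≤ m) :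
    wext (winAt (m := m) a₀ w t) (wordAt a₀ w (t + m)) ⟨i, by omega⟩ = w ⟨t + i, by omega⟩ := by
  by_cases h : i < m
  · rw [wext_lt _ _ h, winAt, wordAt_of_lt]
  · have : i = m := by omega
    subst this
    rw [wext_last, wordAt_of_lt]

/-- Positions along the extended window at `t` = positions of `w` translated by `-wordPos w t`. [folklore] -/
theorem wordPos_wext_winAt (w : Fin N → Fin d × Bool) {t : ℕ} (ht : t + m < N) :
    ∀ {i : ℕ}, i ≤ m + 1 →
      wordPos (wext (winAt (m := m) a₀ w t) (wordAt a₀ w (t + m))) i = wordPos w (t + i) - wordPos w t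
  | 0, _ => by simp
  | i + 1, hi => by
    rw [wordPos_succ _ (by omega : i < m + 1), wordPos_wext_winAt w ht (by omega : i ≤ m + 1),
      show t + (i + 1) = (t + i) + 1 by ring, wordPos_succ w (by omega : t + i < N),
      wext_winAt a₀ w ht (by omega : i ≤ m)]
    abel

/-- A window of a self-avoiding word, extended by its next step, is self-avoiding. [folklore] -/
theorem isSAW_wext_winAt {w : Fin N → Fin d × Bool} (hw : IsSAW w) {t : ℕ} (ht : t + m < N) :
    IsSAW (wext (winAt (m := m) a₀ w t) (wordAt a₀ w (t + m))) := by
  intro i j hi hj hij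
  rw [wordPos_wext_winAt a₀ w ht hi, wordPos_wext_winAt a₀ w ht hj, sub_left_inj] at hij
  have := hw (t + i) (t + j) (by omega) (by omega) hij
  omega

/-- The genuine window chords at time `t`, as index pairs of `w`, are chord pairs of `w`. [folklore] -/
theorem image_winChords_subset_chordPairs {w : Fin N → Fin d × Bool} {t : ℕ} (ht : t + m < N) :
    ((Finset.range m).filter fun j => (zdGraph d).Adj
        (wordPos (wext (winAt (m := m) a₀ w t) (wordAt a₀ w (t + m))) j)
        (wordPos (wext (winAt (m := m) a₀ w t) (wordAt a₀ w (t + m))) (m + 1))).image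
      (fun j => (t + j, t + m + 1)) ⊆ chordPairs w := by
  intro q hq
  rw [Finset.mem_image] at hq
  obtain ⟨j, hj, rfl⟩ := hq
  rw [Finset.mem_filter, Finset.mem_range] at hj
  obtain ⟨hjm, hadj⟩ := hj
  rw [wordPos_wext_winAt a₀ w ht (by omega), wordPos_wext_winAt a₀ w ht le_rfl,
    Literature.Probability.RandomPlanarGeometry.SAW.Zd.zdGraph_adj_sub_right,
    show t + (m + 1) = t + m + 1 by ring] at hadj
  exact mem_chordPairs.2 ⟨by simp only; omega, by simp only; omega, hadj⟩

/-- **Chord accounting.** Along a self-avoiding word of length `N ≥ m + k`, the genuine window chord counts of the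
first `k` steps add up to at most the number of chord edges (the charged pairs are distinct chord pairs).
[folklore] -/
theorem sum_winChordTrue_le_card_chordEdges {w : Fin N → Fin d × Bool} (hw : IsSAW w) {k : ℕ} (hk : m + k ≤ N) :
    ∑ t ∈ Finset.range k, winChordTrue (winAt (m := m) a₀ w t) (wordAt a₀ w (t + m)) ≤ (chordEdges w).card := by
  classical
  set F : ℕ → Finset (ℕ × ℕ) := fun t =>
    ((Finset.range m).filter fun j => (zdGraph d).Adj
        (wordPos (wext (winAt (m := m) a₀ w t) (wordAt a₀ w (t + m))) j)
        (wordPos (wext (winAt (m := m) a₀ w t) (wordAt a₀ w (t + m))) (m + 1))).image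
      (fun j => (t + j, t + m + 1)) with hF
  have hcard : ∀ t, winChordTrue (winAt (m := m) a₀ w t) (wordAt a₀ w (t + m)) = (F t).card := by
    intro t
    rw [hF, winChordTrue, Finset.card_image_of_injective]
    intro j j' h
    simpa using h
  have hdisj : ∀ t₁ ∈ Finset.range k, ∀ t₂ ∈ Finset.range k, t₁ ≠ t₂ → Disjoint (F t₁) (F t₂) := by
    intro t₁ _ t₂ _ hne
    rw [Finset.disjoint_left]
    intro q h1 h2
    rw [hF, Finset.mem_image] at h1 h2
    obtain ⟨j, -, rfl⟩ := h1
    obtain ⟨j', -, hq⟩ := h2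
    have h2' := congrArg Prod.snd hq
    dsimp only at h2'
    omega
  have hsub : (Finset.range k).biUnion F ⊆ chordPairs w := by
    intro q hq
    rw [Finset.mem_biUnion] at hq
    obtain ⟨t, ht, hq⟩ := hq
    exact image_winChords_subset_chordPairs a₀ (by have := Finset.mem_range.1 ht; omega) hq
  calc ∑ t ∈ Finset.range k, winChordTrue (winAt (m := m) a₀ w t) (wordAt a₀ w (t + m))
      = ∑ t ∈ Finset.range k, (F t).card := Finset.sum_congr rfl fun t _ => hcard t
    _ = ((Finset.range k).biUnion F).card := (Finset.card_biUnion hdisj).symm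
    _ ≤ (chordPairs w).card := Finset.card_le_card hsub
    _ = (chordEdges w).card := IsSAW.card_chordPairs_eq hw

/-! ### The run of the window automaton along a word -/

/-- The word shifted by one step. [folklore] -/
def wdrop (w : Fin (N + 1) → Fin d × Bool) : Fin N → Fin d × Bool := fun i => w ⟨i.1 + 1, by omega⟩

/-- Steps of the shifted word. [folklore] -/
theorem wordAt_wdrop (w : Fin (N + 1) → Fin d × Bool) (i : ℕ) : wordAt a₀ (wdrop w) i = wordAt a₀ w (i + 1) := by
  unfold wordAt wdrop
  by_cases h : i < N
  · simp [h, show i + 1 < N + 1 by omega]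
  · simp [h, show ¬ (i + 1 < N + 1) by omega]

/-- Windows of the shifted word. [folklore] -/
theorem winAt_wdrop (w : Fin (N + 1) → Fin d × Bool) (t : ℕ) :
    winAt (m := m) a₀ (wdrop w) t = winAt a₀ w (t + 1) := by
  funext i; simp only [winAt, wordAt_wdrop]; congr 1; omega

/-- The shifted word of a self-avoiding word is self-avoiding. [folklore] -/
theorem isSAW_wdrop {w : Fin (N + 1) → Fin d × Bool} (hw : IsSAW w) : IsSAW (wdrop w) := by
  have hpos : ∀ i, i ≤ N → wordPos (wdrop w) i = wordPos w (i + 1) - wordPos w 1 := by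
    intro i hi
    induction i with
    | zero => simp [wordPos_succ w (by omega : 0 < N + 1)]
    | succ i ih =>
      rw [wordPos_succ _ (by omega : i < N), ih (by omega), show i + 1 + 1 = (i + 1) + 1 from rfl,
        wordPos_succ w (by omega : i + 1 < N + 1)]
      simp only [wdrop]
      abel
  intro i j hi hj hij
  rw [hpos i hi, hpos j hj, sub_left_inj] at hij
  have := hw (i + 1) (j + 1) (by omega) (by omega) hij
  omega

/-- **The run along a word.** If every window of `w : Fin (m + k) → A` is accepted, the window automaton's run
from the first window over the remaining `k` steps is the product of the transition weights. [folklore] -/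
theorem run_windowAut_eq (ok : (Fin m → Fin d × Bool) → Fin d × Bool → Bool)
    (c : (Fin m → Fin d × Bool) → Fin d × Bool → ℕ) {p : ℝ} (hp0 : 0 ≤ p) (hp1 : p ≤ 1) :
    ∀ (k : ℕ) (w : Fin (m + k) → Fin d × Bool),
      (∀ t < k, ok (winAt a₀ w t) (wordAt a₀ w (t + m)) = true) →
      (windowAut ok c p hp0 hp1).run k (winAt a₀ w 0) (fun j => w ⟨m + j.1, by omega⟩) =
        ∏ t ∈ Finset.range k, p * (1 - p) ^ c (winAt a₀ w t) (wordAt a₀ w (t + m))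
  | 0, w, _ => by simp [WAut.run]
  | k + 1, w, hok => by
    rw [WAut.run_succ]
    have h0 : (fun j : Fin (k + 1) => w ⟨m + j.1, by omega⟩) 0 = wordAt a₀ w (0 + m) := by
      rw [zero_add, wordAt_of_lt a₀ w (by omega : m < m + (k + 1))]; rfl
    have hstep : (windowAut ok c p hp0 hp1).step (winAt a₀ w 0) ((fun j : Fin (k + 1) => w ⟨m + j.1, by omega⟩) 0)
        = some (winAt a₀ w 1) := by
      rw [h0]
      show (if ok (winAt a₀ w 0) (wordAt a₀ w (0 + m)) then some (wshift (winAt a₀ w 0) (wordAt a₀ w (0 + m)))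
        else none) = some (winAt a₀ w 1)
      rw [hok 0 (by omega), if_pos rfl, wshift_winAt]
    rw [hstep]
    simp only
    have htail : Fin.tail (fun j : Fin (k + 1) => w ⟨m + j.1, by omega⟩)
        = fun j : Fin k => (wdrop (N := m + k) w) ⟨m + j.1, by omega⟩ := by
      funext j
      show w _ = w _
      exact congrArg w (Fin.ext (by simp only [Fin.val_succ]; omega))
    have ih := run_windowAut_eq ok c hp0 hp1 k (wdrop (N := m + k) w) (fun t ht => by
      rw [winAt_wdrop, wordAt_wdrop, show t + m + 1 = (t + 1) + m by ring]; exact hok (t + 1) (by omega))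
    rw [htail, ← winAt_wdrop a₀ w 0, ih, Finset.prod_range_succ' _ k]
    simp only [winAt_wdrop, wordAt_wdrop, h0]
    rw [mul_comm]
    congr 1
    refine Finset.prod_congr rfl fun t _ => ?_
    rw [show t + m + 1 = t + 1 + m by ring]

end Summit.CriticalPhenomena.PercolationContinuityZ3.Theorems.Pcint
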